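import Summits.HodgeConjecture.HodgeConjecture.Theorems.EquidimSocketThickLinkedLift        -- ★ socket (A) `thickLinkedLift_heckeLinked_pow` and its whole ★ import cone
import Summits.HodgeConjecture.HodgeConjecture.Theorems.EquidimHeckeLinkedAtLiftDeg           -- (E-b) `heckeLinkedDeg_at_ellAdicMove'`
import Literature.AlgebraicGeometry.ModuliOfAbelianVarieties.SiegelHeckeLinkDegree              -- (E-a) DEF `HeckeLinkedDeg` (B-p14 (g14))
import HarnessLib

/-!
# The thick Hecke-linked lift, OPEN-PIECE + DEGREE edition — socket (A) of the Hecke link in the shape socket (B) v7 consumes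

Layer `Summits/HodgeConjecture/HodgeConjecture/Theorems` (helper toward the crux `stub_noThinPiece` of the registered skeleton
`Cruxes/HDel/Lines/EquidimOfF.lean`, item stmt-HodgeConjecture-24835; cell hodgecm-mathlib, seat B-p18 (g17), B-plan1 (g15) rulings
2026-08-29T23:17:31Z / 23:19:57Z / 23:33:35Z = SOCKET (B) TEXT v7 → v8, package (E-c)).  THEOREMS ONLY.  Companion («ed.3») of ★
`Theorems/EquidimSocketThickLinkedLift` (B-p08/B-p13/B-p01 lineage): the SAME assembly, exporting two data the ★ editions have in
hand and drop at their final anonymous constructor —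

1. `IsOpenImmersion ι′.left` for the piece `ι′ : S″ ⟶ 𝓜′_ℂ` (★ `EquidimThickLift.exists_lift_le_relDim` produces `S″` as an OPEN PIECE of
   `𝓜′_ℂ`; socket (B) v7 needs it: `S″.left` separated / locally Noetherian for ★ `quotientBy`, quasi-projective for the affine
   covers of the quotient construction — B-plan1 (g15) 23:17:31Z);
2. the DEGREE of the link, `HeckeLinkedDeg 𝓜 𝓜′ r′ (ι′ s′) x (N′ / N)` (E-a, B-p14 (g14)): the `ℓ`-adic move ★ `exists_ellAdicMove_integral`
   delivers `ᵗγ E_δ γ = ℓᴷ • E_δ` with the SAME `K` as the lifted level `N′ = N·ℓᴷ`, i.e. `ν = N′/N` (B-plan1 (g15) 23:19:57Z: every ★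
   producer of the quotient triple lives at `N′ = N·ν`, so the socket may demand `hfam` only at `ν := N′/N`).

* `thickLinkedLift_heckeLinkedDeg_pow_open` — ★ `thickLinkedLift_heckeLinked_pow` :236–:342 verbatim with `hι′` kept and the link
  produced by (E-b) `EquidimHeckeLinkDeg.heckeLinkedDeg_at_ellAdicMove'` (`N′/N = ℓᴷ` by `Nat.mul_div_cancel_left`, as at ★ :326);
* `thickLinkedLift_heckeLinkedDeg_odd_open` — the v8 socket-(A) text (B-plan1 (g15) 23:33:35Z, `SOCKET-B-v8.text` 50c62588):
  `… ∧ HeckeLinkedDeg … (N′ / N) ∧ Odd (N′ / N) ∧ Nat.Coprime (N′ / N) (∏ i, δ i)` — `ℓ :=` a PRIME `> N·∏ δᵢ` (Euclid) in `_pow_open`,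
  so `N′/N = ℓᴷ` is odd and prime to `∏ δᵢ` (the kernel orders of the Hecke quotient are powers of `N′/N`; ★
  `Polarization.hasType_of_fibreIsogenyData` wants them prime to `∏ δᵢ` — B-p21 (g14) / B-p03 (g15) flag 23:32Z).

Consumers: (E-e) `Theorems/EquidimNoThinPieceOpen` (B-p17 (g10): `stubThick_of_quotientMaps₃` / `noThinPiece_of_quotientMaps₃`, `hQuot₃ :=`
v8 text, `obtain ⟨…, hι′, d″, hd″, r′, hr′, s′, hthick, hlink, hodd, hcop⟩`, `haveI := hι′` before the call) and the E-road v1.4 closing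
write.  HC_CM is proved only modulo the 7 printed citations until rung 0 closes; this file discharges none of them.

## References
* [MumfordFogartyKirwan1994] D. Mumford, J. Fogarty, F. Kirwan, *Geometric Invariant Theory*, 3rd ed., App. 7A (p. 235).
* [Milne2005ShimuraVarieties] J. S. Milne, *Introduction to Shimura Varieties*, §5 p. 58, §6 Thm. 6.11 pp. 74–75.
* [PlatonovRapinchuk1994] V. Platonov, A. Rapinchuk, *Algebraic Groups and Number Theory*, §7.4 Thm. 7.12.
* [Deligne1971TravauxShimura] P. Deligne, *Travaux de Shimura*, Sém. Bourbaki 389 (1971), 4.11–4.12 pp. 148–149.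
-/

set_option linter.dupNamespace false

noncomputable section

open CategoryTheory AlgebraicGeometry Matrix Topology
open Literature.AlgebraicGeometry
open Literature.AlgebraicGeometry.Motives (SchemeOver ComplexPoints AlgPoints specOver)
open Literature.AlgebraicGeometry.AbelianSchemes (PolarizedAbelianSchemeWithLevel)
open Literature.AlgebraicGeometry.ModuliOfAbelianVarieties
open Literature.NumberTheory.Automorphic (siegelUpperHalfSpace)
open Literature.NumberTheory.Adeles
open Literature.NumberTheory.ModularForms Literature.NumberTheory.ModularForms.SiegelUpperHalfSpace

namespace Summit.HodgeConjecture.HodgeConjecture.Theorems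

namespace EquidimSocketThickLinkedLiftOpen

open SiegelModuli SiegelModuliTower
open Summit.HodgeConjecture.CorCM.HypDel.UHead (exists_residue_isAdmissibleAt isAdmissibleAt_of_classifyingMap_eq)
open EquidimSocketThickLinkedLift (exists_isAdmissibleAt_mul_of_changeLevel')

variable {g : ℕ} {δ : Fin g → ℕ}

/-- **THE THICK HECKE-LINKED LIFT ALONG `N′ = N·ℓᴷ`, OPEN PIECE + DEGREE** («ed.3» of ★ `thickLinkedLift_heckeLinked_pow`: the
same assembly with `IsOpenImmersion ι′.left` and the degree `N′/N = ℓᴷ` of the link EXPORTED; B-plan1 (g15) 2026-08-29T23:17:31Z /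
23:19:57Z socket (B) text v7).  Under (F) [Lan2013], for every Siegel fine moduli scheme `𝓜` (any `g ≥ 1`, polarisation type `δ`,
level `N ≥ 3`), every complex point `x` of `𝓜_ℂ` and every `ℓ ≥ 2` prime to `N` there are a level `N′ = N·ℓᴷ`, a fine moduli scheme
`𝓜′` of that level, a smooth OPEN piece `ι′ : S″ ⟶ 𝓜′_ℂ` (an open immersion) of relative dimension `d″`, a principal representative
`r′ ∈ K_δ(1)` and a complex point `s′` of `S″` such that `S″` is THICK at `s′` read at `r′` (★ `EquidimOfF.IsThickAtWith`) and `ι′ s′`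
is HECKE-LINKED WITH DEGREE `N′/N` to `x` at `r′` ((E-a) `HeckeLinkedDeg`).  Assembly of ★ bricks exactly as in ★
`thickLinkedLift_heckeLinked_pow`: `x`'s triple and residue reading, U-a at that reading, a thick piece through `x`'s component (★ H0_c
`EquidimThickPiece.exists_openPiece_le_at`), its period chart read at `r` (★ `EquidimThickIffLe.isThickAtWith_of_isAdmissibleAt`), the
`ℓ`-adic move into it (★ B3+ `exists_ellAdicMove_integral`, similitude factor `ℓᴷ`), the thick lift along the tower (★
`EquidimThickLift.exists_lift_le_relDim` — which yields the open immersion — over ★ (P1) `SiegelModuliTower.exists_comp_tr_eq` and ★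
(R4) `SiegelModuliTower.trLiftsRelDim`), the reading alignment (★ (U)′) and the link with degree at the lifted point ((E-b)
`EquidimHeckeLinkDeg.heckeLinkedDeg_at_ellAdicMove'`). [cite: MumfordFogartyKirwan1994, App. 7A (p. 235)]
[cite: Milne2005ShimuraVarieties, §6 Thm. 6.11 pp. 74–75, §5 p. 58] [cite: PlatonovRapinchuk1994, §7.4 Thm. 7.12] -/
theorem thickLinkedLift_heckeLinkedDeg_pow_open (hF : lan2013_siegelFineModuliScheme) (g N : ℕ) (δ : Fin g → ℕ) (hg : 0 < g)
    (hδ : IsPolarizationType δ) (hN : 3 ≤ N) (𝓜 : SiegelFineModuliScheme g N δ)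
    (x : ComplexPoints ((Motives.baseChange ℚ ℂ).obj 𝓜.M)) (ℓ : ℕ) (hℓ : 2 ≤ ℓ) (hℓN : Nat.Coprime ℓ N) :
    ∃ (N' : ℕ) (δ' : Fin g → ℕ) (hδ' : IsPolarizationType δ') (𝓜' : SiegelFineModuliScheme g N' δ')
      (S'' : SchemeOver ℂ) (ι' : S'' ⟶ (Motives.baseChange ℚ ℂ).obj 𝓜'.M) (_ : IsOpenImmersion ι'.left)
      (d'' : ℕ) (_ : SmoothOfRelativeDimension d'' S''.hom) (r' : gspFinAdelic δ') (_ : r' ∈ principalLevelSubgroup δ' 1)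
      (s' : ComplexPoints S''),
      (∃ K : ℕ, N' = N * ℓ ^ K) ∧
      EquidimOfF.IsThickAtWith hδ' 𝓜' ι' d'' s' r' ∧ HeckeLinkedDeg 𝓜 𝓜' r' (AlgPoints.map (L := ℂ) ι' s') x (N' / N) := by
  have hP4 := UeP4OfFPiece.ue_P4_piece_of_F hF
  have hLiftRD : ∀ {g : ℕ} {δ : Fin g → ℕ} (hg : 0 < g)
      (𝓜 : ∀ K : SiegelLevel δ, SiegelFineModuliScheme g K.N δ) {K K' : SiegelLevel δ} (f : K ⟶ K')
      (_hK : Smooth (𝓜 K).M.hom) (_hK' : Smooth (𝓜 K').M.hom)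
      {S'' S' : SchemeOver ℂ} (ι'' : S'' ⟶ (Motives.baseChange ℚ ℂ).obj (𝓜 K).M) [IsOpenImmersion ι''.left]
      (d'' : ℕ) [SmoothOfRelativeDimension d'' S''.hom]
      (ι : S' ⟶ (Motives.baseChange ℚ ℂ).obj (𝓜 K').M) [IsOpenImmersion ι.left] (d : ℕ) [SmoothOfRelativeDimension d S'.hom]
      (s'' : ComplexPoints S'') (s : ComplexPoints S'),
      AlgPoints.map ((Motives.baseChange ℚ ℂ).map (tr hg 𝓜 f)) (AlgPoints.map ι'' s'') = AlgPoints.map ι s → d ≤ d'' := by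
    intro g δ hg 𝓜 K K' f hK hK' S'' S' ι'' _ d'' _ ι _ d _ s'' s h
    exact SiegelModuliTower.trLiftsRelDim hg 𝓜 f hK hK' ι'' d'' ι d s'' s h
  classical
  haveI : IsLocallyNoetherian (specOver ℚ ℂ).left := inferInstanceAs (IsLocallyNoetherian (Spec (CommRingCat.of ℂ)))
  -- ### tower typing: `N = K₀.N`, `𝓜 = 𝓜f K₀`
  -- (the witnesses are hidden behind `have`s so that `K₀`, `𝓜f` stay OPAQUE locals — no `Function.update` unfolding later)
  have hK₀ : ∃ K₀ : SiegelLevel δ, K₀.N = N := ⟨SiegelLevel.ofNat δ N hN, SiegelLevel.N_ofNat hg N hN⟩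
  obtain ⟨K₀, rfl⟩ := hK₀
  have h𝓜f : ∃ 𝓜f : ∀ K : SiegelLevel δ, SiegelFineModuliScheme g K.N δ, 𝓜f K₀ = 𝓜 :=
    ⟨Function.update (fun K ↦ (hF g K.N δ hg hδ K.three_le_N).choose) K₀ 𝓜,
      Function.update_self (β := fun K : SiegelLevel δ ↦ SiegelFineModuliScheme g K.N δ) K₀ 𝓜 _⟩
  obtain ⟨𝓜f, rfl⟩ := h𝓜f
  have hN0 : 0 < K₀.N := by have := K₀.three_le_N; omega
  haveI : Fact (1 < K₀.N) := ⟨by have := K₀.three_le_N; omega⟩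
  -- ### `x`'s triple and its reading `(Zx, r)`, `r` of residue form
  obtain ⟨Px, -, -, -, hx⟩ := (𝓜f K₀).exists_triple_isBaseChangeVia_classifyingPoint_eq x
  obtain ⟨c, u₀, r, hu1, huc, hr, hmult, hrform, Zx, hZx, hPx⟩ := exists_residue_isAdmissibleAt hg hδ K₀.three_le_N Px
  have hUa := UHead.Ua_holds_of_residual Literature.AlgebraicGeometry.Motives.AbelianVariety.U_a3_residual_of_M13 g K₀.N δ hg
    hδ K₀.three_le_N c u₀ r hu1 huc hr hmult hrform
  -- ### H0_c: a thick piece with a point read at `r`; its period chart read at `r`; the open set `V` of periods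
  obtain ⟨S₀, ι₀, hι₀, d₀, hd₀, t₀, Z₀, hZ₀, P₀, hG, hadm₀, hcls₀⟩ :=
    EquidimThickPiece.exists_openPiece_le_at hF hP4 hg hδ K₀.three_le_N (𝓜f K₀) hr hUa
  haveI := hι₀
  haveI := hd₀
  haveI : Smooth S₀.hom := SmoothOfRelativeDimension.smooth d₀ _
  haveI : LocallyOfFiniteType S₀.hom := inferInstance
  obtain ⟨W, π, hWo, ht₀W, -, -, hread, hopen⟩ :=
    EquidimThickIffLe.isThickAtWith_of_isAdmissibleAt hF hg hδ K₀.three_le_N (𝓜f K₀) ι₀ d₀ t₀ hG hr (Z := ⟨Z₀, hZ₀⟩) P₀ hadm₀ hcls₀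
  obtain ⟨V, hVo, hVne, hVsub⟩ := hopen Set.univ isOpen_univ (Set.mem_univ _)
  -- ### B3+: the `ℓ`-adic move into `V`
  obtain ⟨P, γ, Kx, hPV, hJ, hγ, hγN, hγ', hsim⟩ :=
    exists_ellAdicMove_integral ℓ K₀.N hℓ hN0 hℓN hδ.1 ⟨Zx, hZx⟩ hVo hVne
  -- the moved period is the period of a point `t′` of the thick piece, with a triple `Q` admissible at `(P • Zx, r)`
  obtain ⟨t', ht', hπt'⟩ := hVsub ⟨_, hPV, rfl⟩
  obtain ⟨hπZ, Q, hQadm, hQcls⟩ := hread t' ht'.1.1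
  -- ### the upstairs level `K`, `K.N = N·ℓ^Kx`, and `f : K ⟶ K₀`
  have h3 : 3 ≤ K₀.N * ℓ ^ Kx := le_mul_of_le_of_one_le K₀.three_le_N (Nat.one_le_pow _ _ (by omega))
  have hKex : ∃ K : SiegelLevel δ, K.N = K₀.N * ℓ ^ Kx :=
    ⟨SiegelLevel.ofNat δ _ h3, SiegelLevel.N_ofNat hg _ h3⟩
  obtain ⟨K, hK⟩ := hKex
  have hle : K ≤ K₀ := by
    change (K.1 : Subgroup (gspFinAdelic δ)) ≤ K₀.1
    rw [SiegelLevel.val_eq, SiegelLevel.val_eq]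
    exact principalLevelSubgroup_anti δ (Dvd.intro _ hK.symm)
  let f : K ⟶ K₀ := homOfLE hle
  have hKN0 : K.N ≠ 0 := by have := K.three_le_N; omega
  -- smoothness of the members (for (R4))
  obtain ⟨hMsK, -, -⟩ := W1.smooth_qproj_of_F hF hg hδ K.three_le_N (𝓜f K)
  obtain ⟨hMsK₀, -, -⟩ := W1.smooth_qproj_of_F hF hg hδ K₀.three_le_N (𝓜f K₀)
  -- ### the THICK LIFT of `t′` — an OPEN piece `ι′ : S″ ⟶ 𝓜′_ℂ` (the open immersion `hι'` is EXPORTED below)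
  obtain ⟨S'', ι', hι', -, -, d'', hd'', y, hdle, hy⟩ :=
    EquidimThickLift.exists_lift_le_relDim hF hg hδ 𝓜f f (SiegelModuliTower.exists_comp_tr_eq hg 𝓜f f)
      (fun ι'' _ d'' _ ι _ d _ s'' s h ↦ hLiftRD hg 𝓜f f hMsK hMsK₀ ι'' d'' ι d s'' s h) ι₀ d₀ t'
  haveI := hι'
  haveI := hd''
  haveI : Smooth S''.hom := SmoothOfRelativeDimension.smooth d'' _
  haveI : LocallyOfFiniteType S''.hom := inferInstance
  -- ### `y`'s triple `P₀′` (level `K.N`), its shadow is classified like `Q` ⇒ admissible at `(P • Zx, r)`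
  obtain ⟨P₀', -, -, -, hy'⟩ := (𝓜f K).exists_triple_isBaseChangeVia_classifyingPoint_eq (AlgPoints.map ι' y)
  have hshadow : ∀ (m : ℕ) (hKm : K.N = K₀.N * m), m = K.N / K₀.N →
      IsAdmissibleAt hδ r _ hπZ (P₀'.changeLevel K₀.N m hKm hKN0) := by
    rintro m hKm rfl
    refine isAdmissibleAt_of_classifyingMap_eq hδ (𝓜f K₀) ?_ hQadm
    -- `cls Q = cls (shadow) = cls P₀′ ≫ tr f`, read on complex points: `cls Q ↦ ι₀ t′ = tr_ℂ (ι′ y)`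
    apply (AlgPoints.baseChangeEquiv (algebraMap ℚ ℂ) (𝓜f K₀).M).injective
    rw [hQcls, ← classifyingMap_comp_tr hg 𝓜f f]
    have hnat := Summit.HodgeConjecture.CorCM.D2Bridge.AlgPoints.baseChangeEquiv_map (algebraMap ℚ ℂ) (tr hg 𝓜f f)
      ((𝓜f K).classifyingMap (specOver ℚ ℂ) P₀')
    change AlgPoints.baseChangeEquiv (algebraMap ℚ ℂ) (𝓜f K₀).M (AlgPoints.map (tr hg 𝓜f f) _) =
      AlgPoints.map ((Motives.baseChange ℚ ℂ).map (tr hg 𝓜f f)) _ at hnat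
    rw [AlgPoints.map_apply] at hnat
    rw [hnat, hy', hy]
  have hm : ℓ ^ Kx = K.N / K₀.N := by rw [hK, Nat.mul_div_cancel_left _ hN0]
  have hadm_sh := hshadow (ℓ ^ Kx) hK hm
  -- ### (U): align the reading of `P₀′` to `(P • Zx, r·u)`
  obtain ⟨-, -, r₀, -, -, hr₀, -, -, Z₀', hZ₀', hP₀'read⟩ := exists_residue_isAdmissibleAt hg hδ K.three_le_N P₀'
  obtain ⟨u, hu, hadm'⟩ := exists_isAdmissibleAt_mul_of_changeLevel' hg hδ K₀.three_le_N hr hr₀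
    (P • (⟨Zx, hZx⟩ : siegelUpperHalfSpace g)) ⟨Z₀', hZ₀'⟩ (Nat.pow_pos (by omega)) K.N hK hKN0 P₀' hP₀'read
    (by simpa [hπt'] using hadm_sh)
  have hru : r * u ∈ principalLevelSubgroup δ 1 :=
    Subgroup.mul_mem _ hr (principalLevelSubgroup_anti δ (one_dvd K₀.N) hu)
  -- ### thickness at `y` read at `r·u`, and the link WITH ITS DEGREE `ℓ^Kx = K.N / K₀.N`
  have hthick : EquidimOfF.IsThickAtWith hδ (𝓜f K) ι' d'' y (r * u) :=
    EquidimThickIffLe.isThickAtWith_of_isAdmissibleAt hF hg hδ K.three_le_N (𝓜f K) ι' d'' y (hG.trans hdle) hru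
      (Z := P • (⟨Zx, hZx⟩ : siegelUpperHalfSpace g)) P₀' hadm' hy'
  have hlink : HeckeLinkedDeg (𝓜f K₀) (𝓜f K) (r * u) (AlgPoints.map (L := ℂ) ι' y) x (ℓ ^ Kx) :=
    EquidimHeckeLinkDeg.heckeLinkedDeg_at_ellAdicMove' hg hδ K₀.three_le_N hℓ K.N hK (𝓜f K₀) (𝓜f K) P γ hJ hγ hγ' hsim hγN
      hr hu ⟨Zx, hZx⟩ Px hPx hx P₀' hadm' hy'
  rw [hm] at hlink
  exact ⟨K.N, δ, hδ, 𝓜f K, S'', ι', hι', d'', hd'', r * u, hru, y, ⟨Kx, hK⟩, hthick, hlink⟩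

/-- **SOCKET (A), v8 TEXT: the thick Hecke-linked lift over an OPEN piece, WITH DEGREE `N′/N`, `N′/N` ODD AND PRIME TO `∏ δᵢ`**
(B-plan1 (g15) 2026-08-29T23:17:31Z / 23:19:57Z / 23:33:35Z: socket (B)'s quotient road needs `IsOpenImmersion ι′.left`, demands `hfam`
only at the degree `ν := N′/N`, its ampleness argument needs `N′/N` odd, and its `hasType` road — ★ `Polarization.hasType_of_fibreIsogenyData`
— needs the kernel orders, powers of `N′/N`, prime to `∏ δᵢ`).  All FREE on the (A) side: take a PRIME `ℓ > N·∏ δᵢ` (Euclid,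
`Nat.exists_infinite_primes`) in `thickLinkedLift_heckeLinkedDeg_pow_open` — `ℓ ∤ N` and `ℓ ∤ ∏ δᵢ` since both are positive and `< ℓ`,
and `ℓ ≠ 2` since `ℓ > N·∏ δᵢ ≥ 3`; then `N′ = N·ℓᴷ`, so `N′/N = ℓᴷ` is odd and prime to `∏ δᵢ` (`Odd.pow`, `Nat.Coprime.pow_left`).
(★ `thickLinkedLift_heckeLinked_odd` :349–:365 is the `ℓ := 2N+1` edition without the coprimality.)
[cite: MumfordFogartyKirwan1994, App. 7A (p. 235)] [cite: Milne2005ShimuraVarieties, §6 Thm. 6.11 pp. 74–75] -/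
theorem thickLinkedLift_heckeLinkedDeg_odd_open (hF : lan2013_siegelFineModuliScheme) (g N : ℕ) (δ : Fin g → ℕ) (hg : 0 < g)
    (hδ : IsPolarizationType δ) (hN : 3 ≤ N) (𝓜 : SiegelFineModuliScheme g N δ)
    (x : ComplexPoints ((Motives.baseChange ℚ ℂ).obj 𝓜.M)) :
    ∃ (N' : ℕ) (δ' : Fin g → ℕ) (hδ' : IsPolarizationType δ') (𝓜' : SiegelFineModuliScheme g N' δ')
      (S'' : SchemeOver ℂ) (ι' : S'' ⟶ (Motives.baseChange ℚ ℂ).obj 𝓜'.M) (_ : IsOpenImmersion ι'.left)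
      (d'' : ℕ) (_ : SmoothOfRelativeDimension d'' S''.hom) (r' : gspFinAdelic δ') (_ : r' ∈ principalLevelSubgroup δ' 1)
      (s' : ComplexPoints S''),
      EquidimOfF.IsThickAtWith hδ' 𝓜' ι' d'' s' r' ∧
        HeckeLinkedDeg 𝓜 𝓜' r' (AlgPoints.map (L := ℂ) ι' s') x (N' / N) ∧ Odd (N' / N) ∧
          Nat.Coprime (N' / N) (∏ i, δ i) := by
  have hN0 : 0 < N := by omega
  -- `P := ∏ δᵢ > 0`; a prime `ℓ` with `N·P < ℓ`
  have hP : 0 < ∏ i, δ i := Finset.prod_pos fun i _ => hδ.1 i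
  obtain ⟨ℓ, hℓle, hℓp⟩ := Nat.exists_infinite_primes (N * ∏ i, δ i + 1)
  have hNle : N ≤ N * ∏ i, δ i := Nat.le_mul_of_pos_right N hP
  have hPle : ∏ i, δ i ≤ N * ∏ i, δ i := Nat.le_mul_of_pos_left _ hN0
  have hℓN : Nat.Coprime ℓ N := (Nat.Prime.coprime_iff_not_dvd hℓp).2 fun h => by
    have := Nat.le_of_dvd hN0 h
    omega
  have hℓP : Nat.Coprime ℓ (∏ i, δ i) := (Nat.Prime.coprime_iff_not_dvd hℓp).2 fun h => by
    have := Nat.le_of_dvd hP h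
    omega
  have hℓodd : Odd ℓ := hℓp.odd_of_ne_two (by omega)
  obtain ⟨N', δ', hδ', 𝓜', S'', ι', hι', d'', hd'', r', hr', s', ⟨K, hK⟩, hthick, hlink⟩ :=
    thickLinkedLift_heckeLinkedDeg_pow_open hF g N δ hg hδ hN 𝓜 x ℓ hℓp.two_le hℓN
  refine ⟨N', δ', hδ', 𝓜', S'', ι', hι', d'', hd'', r', hr', s', hthick, hlink, ?_⟩
  rw [hK, Nat.mul_div_cancel_left _ hN0]
  exact ⟨hℓodd.pow, Nat.Coprime.pow_left K hℓP⟩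

end EquidimSocketThickLinkedLiftOpen

end Summit.HodgeConjecture.HodgeConjecture.Theorems

end
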